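import Literature.IUT.HodgeTheaters.GoodLocalFrobenioidOfKitCdashFromF
import Literature.AlgebraicGeometry.Frobenioids.PadicFrobenioidQpSplit
import Literature.AlgebraicGeometry.Frobenioids.ArchimedeanPointBaseThm36
import HarnessLib

/-!
# [IUTchI] Example 3.3 (iii) (d): NON-VACUITY certificate for the binder list of `GoodLocalFrobenioid.cdashFromF_ofKit_of‴`

Mochizuki, *Inter-universal Teichmüller theory I*, kurims manuscript (May 2020), Example 3.3 (iii) (d), p. 79
[claim: Mochizuki2012, status: disputed] — nothing of the series is asserted; no side is taken on [IUTchIII] Cor. 3.12.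

NON-VACUITY certificate (abc-iut cell, seat abc-iut-L1-t4 gen 6; proof-only, 0 definitions): the binder list
`{IsOfFSMType D_v, IsSlim D_v, hbase, hram}` of `GoodLocalFrobenioid.cdashFromF_ofKit_of‴`
(`GoodLocalFrobenioidOfKitCdashFromF.lean`) is JOINTLY INHABITED at the DEGENERATE instance `ofKitQp p`
(`D_v = D⊢_v =` the one-object category, `K_v = ℚ_p`, abc-iut-L1-t4's `qpBase`): the one-object base is of FSM-type and
slim (`PadicFrd.isOfFSMType_discretePUnit`, `isSlim_discretePUnit`), `hbase` is trivial for `incl = 𝟭`, and `hram` holds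
with the identity of `ord(ℤ_p^⊳)`. Hence a SECOND, independent kernel route to abc-iut-w4-d047's
`GoodLocalFrobenioid.cdashFromF_ofKitQp` (which goes through fullness of `C⊢ ⊆ C` at `ℚ_p`): here through the non-full
socket + the [FrdI] Cor. 4.11 (iv) transport of `log(p)`-divisors. Inhabited ≠ discharged at the printed object; this
changes no census and no cone token.
-/

namespace Literature.IUT.HodgeTheaters

namespace GoodLocalFrobenioid

open CategoryTheory Opposite Literature.AlgebraicGeometry.Frobenioids Literature.AlgebraicGeometry.Frobenioids.PadicFrd

/-- **NV certificate**: the four binders of `cdashFromF_ofKit_of‴` are jointly inhabited at `ofKitQp p` — so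
[IUTchI] Ex. 3.3 (iii) (d) holds at the degenerate instance by the base-level route (FSM + slim one-object base,
`incl = 𝟭`, identity isomorphism of `ord(ℤ_p^⊳)`). [claim: Mochizuki2012, status: disputed] -/
theorem cdashFromF_ofKitQp_of_baseBinders_inhabited (p : ℕ) [Fact p.Prime] : (ofKitQp p).CdashFromF :=
  cdashFromF_ofKit_of''' (𝟭 (Discrete PUnit.{1})) (𝟭 _) Adjunction.id (qpBase p) (fun _ => isPadicLocal_qpFld p)
    inferInstance isTotallyEpimorphic_discretePUnit inferInstance isTotallyEpimorphic_discretePUnit ℚ_[p]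
    (p_mem_intNonzero p) PadicFrd.isOfFSMType_discretePUnit isSlim_discretePUnit
    (fun _ _ => Functor.obj_mem_essImage _ _)
    (fun _ _ => ⟨MulEquiv.refl _, rfl⟩)

end GoodLocalFrobenioid

end Literature.IUT.HodgeTheaters
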